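import Summits.BirchSwinnertonDyer.BirchSwinnertonDyer.Theorems.PrintCf2RubinValueTwoRowTwoTwistedKummerClass
import Literature.NumberTheory.ComplexMultiplication.EllipticUnits.RubinEulerSystem
import Literature.NumberTheory.GaloisRepresentations.SUnitsRestrictedKummer
import Literature.NumberTheory.GaloisRepresentations.LocalWeilDatum
import HarnessLib

/-!
# M-LINE-PIN / (α3) ROW 2, FILE 3g: twisted Kummer classes of GLOBAL UNITS — independence of the chosen root, and the
# unit-level constructor `exists_root_isTwistedKummerClass`

Cell `bsd-print-cf2`, WIDTH seat `bsd-line-cf2-p1-w6` g9 (prover-bsd-line-cf2-p1-w6-g9-0), successor of g8 on (α3) ROW 2 of the JLK road on the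
DECIDING child stmt-BirchSwinnertonDyer-24721 `PrintCf2RubinValueTwo.MainConjClauseAtSplitTwoQuadDA` (memo `HOME/bsd-line-cf2-p1-w6/ROW2-SPEC-w6g8.md`,
(R2-3)/(R2-9), successor item ρ1); `--supports` that item (helper, Theses-free). HONEST FRAMING: Kummer-theoretic bookkeeping over ty2's predicate
`JohnsonLeungKings2011.IsTwistedKummerClass`; nothing here closes the crux or a registered stub; no summit statement is proved by this seat; BSD is
not proved by any of this. THEOREMS ONLY (no definition, no named fact, no instance, no `sorry`).

WHAT. ROW 2's units-side map sends a global unit `u ∈ ℰ(F_n)` to `cor_{F_n → K̃_n}` of the `t(θ)`-twisted Kummer class of a `p^k`-th ROOT `β` of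
`u` at level `U = Gal(K̄/F_n)` (g8's FILE 3a constructor `exists_isTwistedKummerClass` takes `β`). This file supplies what the instantiation of
g8's abstract lift `RowTwo.exists_lift` (FILE 2) needs about the dependence on the root and about the existence of admissible roots:

* §1 **independence of the root**: `isTwistedKummerClass_mul_of_pow_eq_one` — a class of `β` is a class of `β·ζ` for every `ζ ∈ μ_{p^k}` (the
  cocycles differ by the coboundary of `ζ ∈ (μ_{p^k} ⊗ θ)^{N_S}`, invisible in `H¹`; `θ|_U = 1` makes the twisted action of `U` on `ζ` the Galois
  action); hence `isTwistedKummerClass_iff_of_pow_eq` and **`eq_of_isTwistedKummerClass_of_pow_eq`**: the classes of two `p^k`-th roots of the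
  same unit COINCIDE — the twisted Kummer class depends on `u = β^{p^k}` only;
* §2 **roots of global units inside `K_S`**: `globalUnitsOf_le_sUnits` (global units are `S`-units), `exists_pow_eq_of_mem_sUnits` — for
  `S ⊇ {v ∣ p}` an `N_S`-fixed `S`-unit has, for every `k`, a `p^k`-th root in `K̄` which is an `N_S`-fixed `S`-unit (`K_S` is closed under
  `p`-power roots of `S`-units; the tree's `SUnits.smul_root_eq_self_of_mem_ramificationSubgroup`, iterated);
* §3 **the unit-level constructor** `exists_root_isTwistedKummerClass`: for `F/K` finite with `N_S ≤ Gal(K̄/F)` (`F ⊆ K_S`) and `θ` trivial on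
  `Gal(K̄/F)`, every global unit `u` of `F` has a `p^k`-th root `β` and a twisted Kummer class `c ∈ H¹(G_S(F), μ_{p^k} ⊗ θ)` of `β`; together with
  §1 the class is determined by `u` (`eq_of_isTwistedKummerClass_of_pow_eq`).

presearch: «Kummer class of a unit independent of the chosen root; p-power roots of S-units lie in K_S» → folklore (Serre, *Local Fields* X §3 b;
NSW VIII §3 proof of (8.3.18)); tree: `SUnitsRestrictedKummer` (§1 there), `ContinuousH1.oneCocycleClass_eq_zero_iff`. beyond-print theorem: no.

References: J. Johnson-Leung, G. Kings, J. reine angew. Math. 653 (2011) §3.3 (5)–(6), Cor. 3.4; J.-P. Serre, *Local Fields* X §3 b); J. Neukirch,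
A. Schmidt, K. Wingberg, *Cohomology of Number Fields* VIII §3.
-/

noncomputable section

open scoped Classical

-- the summit namespace `Summit.BirchSwinnertonDyer.BirchSwinnertonDyer` repeats the problem name by design (D-0017)
set_option linter.dupNamespace false
set_option autoImplicit false

open scoped NumberField
open Field IsDedekindDomain
open Literature.NumberTheory.GaloisRepresentations Literature.NumberTheory.GaloisRepresentations.DiscreteGaloisModule
open Literature.NumberTheory.GaloisRepresentations.LocalWeilDatum
open Literature.NumberTheory.ComplexMultiplication.EllipticUnits
open Literature.NumberTheory.ComplexMultiplication.EllipticUnits.JohnsonLeungKings2011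

namespace Summit.BirchSwinnertonDyer.BirchSwinnertonDyer.Theorems.PrintCf2.RowTwo

variable {K : Type} [Field K] [NumberField K] (p : ℕ) [Fact p.Prime] (S : Set (HeightOneSpectrum (𝓞 K)))
  (θ : absoluteGaloisGroup K →ₜ* ℤ_[p]ˣ) (k : ℕ) (U : Subgroup (absoluteGaloisGroup K))

/-! ## §1. Independence of the chosen `p^k`-th root -/

omit [NumberField K] in
/-- **A class of `β` is a class of `β·ζ` for `ζ ∈ μ_{p^k}`** (`θ|_U = 1`, `θ|_{N_S} = 1`, `N_S` fixing `μ_{p^k}`): the two cocycles differ by the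
coboundary `g ↦ g·ζ − ζ` of the element `ζ ∈ (μ_{p^k} ⊗ θ)^{N_S}`, which does not change the class (`oneCocycleClass_eq_zero_iff`).
[cite: JohnsonLeungKings2011, §3.3 (5)–(6) (arXiv p0010:L61–70)] [cite: Serre1979, Ch. X §3 b)] -/
theorem isTwistedKummerClass_mul_of_pow_eq_one (hθU : ∀ σ ∈ U, θ σ = 1) (hθN : ∀ τ ∈ ramificationSubgroup K S, θ τ = 1)
    (hμN : ∀ τ ∈ ramificationSubgroup K S, ∀ ζ : (AlgebraicClosure K)ˣ, ζ ^ (p ^ k) = 1 → τ • ζ = ζ)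
    {β ζ : (AlgebraicClosure K)ˣ} (hζ : ζ ^ (p ^ k) = 1) {c : levelCoh p S θ U k 1}
    (hc : IsTwistedKummerClass p θ S U k β c) : IsTwistedKummerClass p θ S U k (β * ζ) c := by
  classical
  obtain ⟨φ₀, rfl, hφ⟩ := hc
  let X := (coeffGS p S θ k).toTopRep
  let φ : contOneCocycles (subgroupRep X (imGS S U)) := φ₀
  -- `ζ` as an `N_S`-invariant element of `μ_{p^k} ⊗ θ`
  let ζr : rootsOfUnity (p ^ k) (AlgebraicClosure K) := ⟨ζ, (mem_rootsOfUnity _ _).mpr hζ⟩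
  have hvmem : MuCarrier.ofRootsOfUnity ζr ∈
      Representation.invariants ((muTwist p θ k).toRepresentation.comp (ramificationSubgroup K S).subtype) := by
    rw [Representation.mem_invariants]
    intro τ
    apply muVal_injective K (p ^ k)
    change muVal K (p ^ k) (muTwist p θ k (τ : absoluteGaloisGroup K) (MuCarrier.ofRootsOfUnity ζr)) = _
    rw [muTwist_apply_of_apply_eq_one p θ k (hθN τ τ.2), muVal_apply, muVal_ofRootsOfUnity]
    exact hμN τ τ.2 _ hζ
  let v : X := ⟨MuCarrier.ofRootsOfUnity ζr, hvmem⟩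
  have hv : muVal K (p ^ k) ((v : Representation.invariants
      ((muTwist p θ k).toRepresentation.comp (ramificationSubgroup K S).subtype)) : MuCarrier K (p ^ k)) = ζ := rfl
  -- lifts and the action of `U_S` on `v`
  have hlift : ∀ g : imGS S U, ∃ σ ∈ U, toUnramifiedQuot K S σ = (g : GaloisGroupUnramifiedOutside K S) := exists_lift_mem S U
  choose lift hliftU hlift_eq using hlift
  have hρ : ∀ (g : imGS S U), muVal K (p ^ k) (((subgroupRep X (imGS S U)).ρ g v : Representation.invariants
        ((muTwist p θ k).toRepresentation.comp (ramificationSubgroup K S).subtype)) : MuCarrier K (p ^ k)) =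
      lift g • ζ := by
    intro g
    rw [subgroupRep_ρ_apply]
    have hg : ((g : imGS S U) : GaloisGroupUnramifiedOutside K S) = toUnramifiedQuot K S (lift g) := (hlift_eq g).symm
    rw [hg]
    change muVal K (p ^ k) (muTwist p θ k (lift g) _) = _
    rw [muTwist_apply_of_apply_eq_one p θ k (hθU _ (hliftU g)), muVal_apply]
    rfl
  -- the coboundary of `v`
  let ψ : contOneCocycles (subgroupRep X (imGS S U)) :=
    ⟨⟨fun g ↦ (subgroupRep X (imGS S U)).ρ g v - v,
      (((coeffGS p S θ k).continuous_apply_left v).comp continuous_subtype_val).sub continuous_const⟩, fun g h ↦ by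
      change (subgroupRep X (imGS S U)).ρ (g * h) v - v =
        ((subgroupRep X (imGS S U)).ρ g v - v) + (subgroupRep X (imGS S U)).ρ g ((subgroupRep X (imGS S U)).ρ h v - v)
      rw [map_mul]
      change (subgroupRep X (imGS S U)).ρ g ((subgroupRep X (imGS S U)).ρ h v) - v = _
      rw [map_sub]
      abel⟩
  have hψ0 : oneCocycleClass _ ψ = 0 := (oneCocycleClass_eq_zero_iff _ ψ).mpr ⟨v, fun _ ↦ rfl⟩
  refine ⟨φ + ψ, ?_, fun σ hσ ↦ ?_⟩
  · change oneCocycleClass (subgroupRep X (imGS S U)) (φ + ψ) = oneCocycleClass (subgroupRep X (imGS S U)) φ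
    rw [oneCocycleClass_add, hψ0, add_zero]
  have hφσ : muVal K (p ^ k) ((φ.1 ⟨toUnramifiedQuot K S σ, Subgroup.mem_map_of_mem _ hσ⟩ :
      Representation.invariants ((muTwist p θ k).toRepresentation.comp (ramificationSubgroup K S).subtype)) :
        MuCarrier K (p ^ k)) = σ • β / β := hφ σ hσ
  have hg : toUnramifiedQuot K S (lift ⟨toUnramifiedQuot K S σ, Subgroup.mem_map_of_mem _ hσ⟩) = toUnramifiedQuot K S σ := hlift_eq _
  generalize (⟨toUnramifiedQuot K S σ, Subgroup.mem_map_of_mem _ hσ⟩ : imGS S U) = g at hφσ hg ⊢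
  change muVal K (p ^ k) (((φ.1 + ψ.1) g :
      Representation.invariants ((muTwist p θ k).toRepresentation.comp (ramificationSubgroup K S).subtype)) :
        MuCarrier K (p ^ k)) = _
  rw [ContinuousMap.add_apply, Submodule.coe_add, muVal_add, hφσ]
  change σ • β / β * muVal K (p ^ k) ((((subgroupRep X (imGS S U)).ρ g v - v : X) : Representation.invariants
      ((muTwist p θ k).toRepresentation.comp (ramificationSubgroup K S).subtype)) : MuCarrier K (p ^ k)) = _
  rw [Submodule.coe_sub, muVal_sub, hρ g, hv, ← smul_div_eq_of_quot_eq S (β := ζ) (fun τ hτ ↦ hμN τ hτ ζ hζ) hg, smul_mul',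
    mul_div_mul_comm]

omit [NumberField K] in
/-- **The twisted Kummer class depends on `β^{p^k}` only**: if `β'^{p^k} = β^{p^k}` then `c` is a class of `β` iff it is a class of `β'`
(`β' = β·ζ` with `ζ^{p^k} = 1`). [cite: JohnsonLeungKings2011, §3.3 (5)–(6) and Cor. 3.4 (arXiv p0010:L40–70)] [cite: Serre1979, Ch. X §3 b)] -/
theorem isTwistedKummerClass_iff_of_pow_eq (hθU : ∀ σ ∈ U, θ σ = 1) (hθN : ∀ τ ∈ ramificationSubgroup K S, θ τ = 1)
    (hμN : ∀ τ ∈ ramificationSubgroup K S, ∀ ζ : (AlgebraicClosure K)ˣ, ζ ^ (p ^ k) = 1 → τ • ζ = ζ)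
    {β β' : (AlgebraicClosure K)ˣ} (h : β' ^ (p ^ k) = β ^ (p ^ k)) (c : levelCoh p S θ U k 1) :
    IsTwistedKummerClass p θ S U k β c ↔ IsTwistedKummerClass p θ S U k β' c := by
  have hζ : (β⁻¹ * β') ^ (p ^ k) = 1 := by rw [mul_pow, inv_pow, h, inv_mul_cancel]
  have hζ' : (β'⁻¹ * β) ^ (p ^ k) = 1 := by rw [mul_pow, inv_pow, h, inv_mul_cancel]
  constructor
  · intro hc
    have h1 := isTwistedKummerClass_mul_of_pow_eq_one p S θ k U hθU hθN hμN hζ hc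
    rwa [mul_inv_cancel_left] at h1
  · intro hc
    have h1 := isTwistedKummerClass_mul_of_pow_eq_one p S θ k U hθU hθN hμN hζ' hc
    rwa [mul_inv_cancel_left] at h1

omit [NumberField K] in
/-- **Two twisted Kummer classes of two `p^k`-th roots of the same element coincide** (independence of the root + uniqueness of the class,
g8's `isTwistedKummerClass_unique`): the class "`Kummer_k(u) ⊗ t(θ)`" of §3.3 is well defined on `u = β^{p^k}`.
[cite: JohnsonLeungKings2011, §3.3 (5)–(6) and Cor. 3.4 (arXiv p0010:L40–70)] -/
theorem eq_of_isTwistedKummerClass_of_pow_eq (hθU : ∀ σ ∈ U, θ σ = 1) (hθN : ∀ τ ∈ ramificationSubgroup K S, θ τ = 1)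
    (hμN : ∀ τ ∈ ramificationSubgroup K S, ∀ ζ : (AlgebraicClosure K)ˣ, ζ ^ (p ^ k) = 1 → τ • ζ = ζ)
    {β β' : (AlgebraicClosure K)ˣ} (h : β' ^ (p ^ k) = β ^ (p ^ k)) {c c' : levelCoh p S θ U k 1}
    (hc : IsTwistedKummerClass p θ S U k β c) (hc' : IsTwistedKummerClass p θ S U k β' c') : c = c' :=
  isTwistedKummerClass_unique p S θ k U hc ((isTwistedKummerClass_iff_of_pow_eq p S θ k U hθU hθN hμN h c').mpr hc')

/-! ## §2. `p`-power roots of global units inside `K_S` -/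

/-- **Global units are `S`-units** (for every `S`): `u, u⁻¹` integral over `ℤ`, hence over `𝒪_{K,S}`. [folklore] -/
theorem globalUnitsOf_le_sUnits (F : IntermediateField K (AlgebraicClosure K)) :
    globalUnitsOf F ≤ SUnits.sUnits K S (AlgebraicClosure K) := by
  intro u hu
  exact ⟨hu.1.tower_top, hu.2.1.tower_top⟩

/-- **`N_S` fixes the `p^k`-th roots of unity** when `S ⊇ {v ∣ p}` (units form of the tree's
`smul_eq_self_of_mem_ramificationSubgroup_of_pow_eq_one`: `K(μ_{p^∞}) ⊆ K_S`). [cite: NeukirchSchmidtWingberg2008, VIII §3] -/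
theorem smul_eq_self_of_mem_ramificationSubgroup_of_units_pow_eq_one
    (hSp : ∀ v : HeightOneSpectrum (𝓞 K), ((p : ℕ) : 𝓞 K) ∈ v.asIdeal → v ∈ S)
    {τ : absoluteGaloisGroup K} (hτ : τ ∈ ramificationSubgroup K S) (ζ : (AlgebraicClosure K)ˣ) (hζ : ζ ^ (p ^ k) = 1) :
    τ • ζ = ζ := by
  apply Units.ext
  rw [Units.coe_smul]
  exact smul_eq_self_of_mem_ramificationSubgroup_of_pow_eq_one K hSp (n := k)
    (by rw [← Units.val_pow_eq_pow_val, hζ, Units.val_one]) hτ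

/-- **`K_S` is closed under `p`-power roots of `S`-units** (`S ⊇ {v ∣ p}`): an `N_S`-fixed `S`-unit `u ∈ K̄` has, for every `k`, a `p^k`-th
root `β ∈ K̄` which is again an `N_S`-fixed `S`-unit (`K̄` is algebraically closed; the tree's `SUnits.smul_root_eq_self_of_mem_ramificationSubgroup`
— a `p`-th root of an `N_S`-fixed `S`-unit is `N_S`-fixed — iterated `k` times). [cite: NeukirchSchmidtWingberg2008, VIII §3 (proof of (8.3.18))] -/
theorem exists_pow_eq_of_mem_sUnits (hSp : ∀ v : HeightOneSpectrum (𝓞 K), ((p : ℕ) : 𝓞 K) ∈ v.asIdeal → v ∈ S)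
    {u : (AlgebraicClosure K)ˣ} (hu : u ∈ SUnits.sUnits K S (AlgebraicClosure K))
    (huN : ∀ τ ∈ ramificationSubgroup K S, τ • u = u) (k : ℕ) :
    ∃ β : (AlgebraicClosure K)ˣ, β ^ (p ^ k) = u ∧ β ∈ SUnits.sUnits K S (AlgebraicClosure K) ∧
      ∀ τ ∈ ramificationSubgroup K S, τ • β = β := by
  induction k with
  | zero => exact ⟨u, by rw [pow_zero, pow_one], hu, huN⟩
  | succ k ih =>
    obtain ⟨β', hβ'u, hβ'S, hβ'N⟩ := ih
    have hp : 0 < p := (Fact.out : p.Prime).pos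
    obtain ⟨z, hz⟩ := IsAlgClosed.exists_pow_nat_eq (β' : AlgebraicClosure K) hp
    have hz0 : z ≠ 0 := by
      intro h0
      rw [h0, zero_pow hp.ne'] at hz
      exact β'.ne_zero hz.symm
    refine ⟨Units.mk0 z hz0, ?_, ?_, ?_⟩
    · have h1 : (Units.mk0 z hz0) ^ p = β' := Units.ext (by rw [Units.val_pow_eq_pow_val, Units.val_mk0, hz])
      rw [pow_succ', pow_mul, h1, hβ'u]
    · exact SUnits.root_mem_sUnits (n := p) hp (Units.ext (by rw [Units.val_pow_eq_pow_val, Units.val_mk0, hz])) hβ'S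
    · intro τ hτ
      apply Units.ext
      rw [Units.coe_smul, Units.val_mk0]
      exact SUnits.smul_root_eq_self_of_mem_ramificationSubgroup K S hSp hβ'S hβ'N hz hτ

/-! ## §3. The unit-level constructor -/

omit [NumberField K] in
/-- `σ ∈ Gal(K̄/F)` fixes the units of `K̄` lying in `F`. [folklore] -/
theorem smul_units_eq_self_of_mem_galFixing {F : IntermediateField K (AlgebraicClosure K)} {σ : absoluteGaloisGroup K}
    (hσ : σ ∈ galFixing K F) {u : (AlgebraicClosure K)ˣ} (hu : (u : AlgebraicClosure K) ∈ F) : σ • u = u :=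
  Units.ext (by rw [Units.coe_smul]; exact (mem_galFixing_iff K).mp hσ _ hu)

/-- **THE UNIT-LEVEL CONSTRUCTOR.** For `S ⊇ {v ∣ p}`, `F/K` finite with `N_S ≤ Gal(K̄/F)` (`F ⊆ K_S`) and `θ` trivial on `Gal(K̄/F)`: every global
unit `u ∈ ℰ(F)` has a `p^k`-th root `β ∈ K̄` and a twisted Kummer class `c ∈ H¹(G_S(F), μ_{p^k} ⊗ θ)` of `β` — the class "`Kummer_k(u) ⊗ t_p(θ)`" of
§3.3 (5) / Cor. 3.4 (`𝒪_F[1/p]^× ⊗ ℤ_p ⊂ H¹(𝒪_F[1/p], ℤ_p(1))`), at the level `U = Gal(K̄/F)`. (`β` is `N_S`-fixed by §2, `(σβ/β)^{p^k} = σu/u = 1`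
on `Gal(K̄/F)`; then g8's `exists_isTwistedKummerClass`.) [cite: JohnsonLeungKings2011, §3.3 (5)–(6) and Cor. 3.4 (arXiv p0010:L40–70)] -/
theorem exists_root_isTwistedKummerClass (hSp : ∀ v : HeightOneSpectrum (𝓞 K), ((p : ℕ) : 𝓞 K) ∈ v.asIdeal → v ∈ S)
    (F : IntermediateField K (AlgebraicClosure K)) [FiniteDimensional K F] (hNF : ramificationSubgroup K S ≤ galFixing K F)
    (hθF : ∀ σ ∈ galFixing K F, θ σ = 1) {u : (AlgebraicClosure K)ˣ} (hu : u ∈ globalUnitsOf F) :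
    ∃ (β : (AlgebraicClosure K)ˣ) (c : levelCoh p S θ (galFixing K F) k 1),
      β ^ (p ^ k) = u ∧ IsTwistedKummerClass p θ S (galFixing K F) k β c := by
  have huN : ∀ τ ∈ ramificationSubgroup K S, τ • u = u := fun τ hτ ↦ smul_units_eq_self_of_mem_galFixing (hNF hτ) hu.2.2
  obtain ⟨β, hβu, -, hβN⟩ := exists_pow_eq_of_mem_sUnits p S hSp (globalUnitsOf_le_sUnits S F hu) huN k
  have hβU : ∀ σ ∈ galFixing K F, (σ • β / β) ^ (p ^ k) = 1 := by
    intro σ hσ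
    rw [div_pow, ← smul_pow', hβu, smul_units_eq_self_of_mem_galFixing hσ hu.2.2, div_self']
  obtain ⟨c, hc⟩ := exists_isTwistedKummerClass p S θ k (galFixing K F) (isOpen_galFixing K F) hθF (fun τ hτ ↦ hθF τ (hNF hτ))
    (fun _ hτ ζ hζ ↦ smul_eq_self_of_mem_ramificationSubgroup_of_units_pow_eq_one p S k hSp hτ ζ hζ) β hβN hβU
  exact ⟨β, c, hβu, hc⟩

/-- **… and the class does not depend on the root**: any two admissible pairs `(β, c)`, `(β', c')` for the same unit `u` have `c = c'`.
[cite: JohnsonLeungKings2011, §3.3 (5)–(6) and Cor. 3.4 (arXiv p0010:L40–70)] -/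
theorem eq_of_isTwistedKummerClass_of_pow_eq_of_le (hSp : ∀ v : HeightOneSpectrum (𝓞 K), ((p : ℕ) : 𝓞 K) ∈ v.asIdeal → v ∈ S)
    (hNU : ramificationSubgroup K S ≤ U) (hθU : ∀ σ ∈ U, θ σ = 1)
    {β β' : (AlgebraicClosure K)ˣ} (h : β' ^ (p ^ k) = β ^ (p ^ k)) {c c' : levelCoh p S θ U k 1}
    (hc : IsTwistedKummerClass p θ S U k β c) (hc' : IsTwistedKummerClass p θ S U k β' c') : c = c' :=
  eq_of_isTwistedKummerClass_of_pow_eq p S θ k U hθU (fun τ hτ ↦ hθU τ (hNU hτ))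
    (fun _ hτ ζ hζ ↦ smul_eq_self_of_mem_ramificationSubgroup_of_units_pow_eq_one p S k hSp hτ ζ hζ) h hc hc'

end Summit.BirchSwinnertonDyer.BirchSwinnertonDyer.Theorems.PrintCf2.RowTwo

end
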